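import Literature.NumberTheory.Sieve.HardyLittlewoodProofs
import Literature.NumberTheory.LFunctions.RHWave0
import HarnessLib

/-!
# The prime `k`-tuples conjecture in rank `k ≤ 1` is the prime number theorem

`Literature.NumberTheory.Sieve.HardyLittlewoodTuples` (parity.S01) is Hardy–Littlewood's
**Theorem X 1*** (Acta Math. 44 (1923), p. 61, (5·663)–(5·664)): for distinct integers
`b₁, …, b_m`, `P(x; b) ∼ G(b) Li_m(x)`, proved by them only under the unproved "Hypothesis X"
(p. 56) — i.e. the prime `k`-tuples conjecture, stated in the tree in the `x/(log x)^k` form over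
admissible `H : Finset ℤ`.  It is an OPEN conjecture and is **not** discharged anywhere in the tree:
already its case `H = {0, 2}` is Conjecture B (p. 42; the twin prime conjecture, see
`Literature.NumberTheory.Sieve.HardyLittlewoodTuples.twinPrimeConjecture` in
`Literature.NumberTheory.Sieve.HardyLittlewoodProofs`).

This file records, with proofs, exactly how much of the conjecture is *known*, so that the open
content is located precisely at rank `k = #H ≥ 2`:

* rank `0` (`H = ∅`): `π_∅(x) = x`, `𝔖(∅) = 1`, and the asserted asymptotic `x ∼ x` holds
  unconditionally (`hardyLittlewoodTuples_empty`);
* rank `1` (`H = {h}`): `𝔖({h}) = 1` ((5·664) with `m = 1`, `ν = 1`), and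
  `π_{h}(x) = π((x + h)⁺) − π(h⁺)` differs from `π(x)` by at most `h⁺ + (−h)⁺ + π(h⁺)`, so the
  asserted asymptotic `π_{h}(x) ∼ x / log x` is equivalent to the prime number theorem
  `π(x) ∼ x / log x` (Hadamard, de la Vallée Poussin 1896; in the tree the named fact
  `Literature.NumberTheory.LFunctions.primeCounting_isEquivalent`, rh.S08, not yet in Mathlib):
  `hardyLittlewoodTuples_of_card_le_one` (PNT ⇒ rank `≤ 1`) and
  `hardyLittlewoodTuples_card_le_one_iff` (rank `≤ 1` ⇔ PNT);
* in particular the conjecture implies the prime number theorem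
  (`HardyLittlewoodTuples.primeCounting_isEquivalent`).

All asymptotics are along `atTop : Filter ℕ` with real casts, as in the statement file; the
transfer between `ℕ`- and `ℝ`-indexed forms of the prime number theorem
(`isEquivalent_primeCounting_natCast`, `primeCounting_isEquivalent_of_natCast`) uses
`⌊x⌋₊ / x → 1` (Mathlib `tendsto_nat_floor_div_atTop`).  Nothing here weakens or restates
`HardyLittlewoodTuples`; no new definitions.

## References

* G. H. Hardy, J. E. Littlewood, *Some problems of 'Partitio numerorum'; III: On the expression of
  a number as a sum of primes*, Acta Math. 44 (1923), 1–70: Conjecture B p. 42, Hypothesis X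
  p. 56, Theorem X 1 ((5·663)–(5·664)) p. 61. doi:10.1007/BF02403921. [HardyLittlewood1923]
* C.-J. de la Vallée Poussin, *Recherches analytiques sur la théorie des nombres premiers*,
  Ann. Soc. Sci. Bruxelles 20 (1896) (the prime number theorem). [Poussin1896]
-/

noncomputable section

open Filter Finset Asymptotics
open scoped Topology

namespace Literature.NumberTheory.Sieve

/-! ### Singular series of the empty tuple and of singletons -/

/-- `ν_∅(p) = 0`: the empty tuple occupies no residue class. [folklore] -/
theorem tupleResidueCount_empty (p : ℕ) : tupleResidueCount ∅ p = 0 := by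
  simp [tupleResidueCount]

/-- `ν_{h}(p) = 1`: a singleton occupies exactly one residue class modulo every `p`. [folklore] -/
theorem tupleResidueCount_singleton (h : ℤ) (p : ℕ) : tupleResidueCount {h} p = 1 := by
  simp [tupleResidueCount]

/-- Singletons are admissible (`ν_{h}(p) = 1 < p` for every prime `p`). [folklore] -/
theorem isAdmissibleTuple_singleton (h : ℤ) : IsAdmissibleTuple {h} := fun p hp ↦ by
  simpa only [tupleResidueCount_singleton] using hp.one_lt

/-- The Euler factor of the empty tuple is `(1 - 0/p) · (1 - 1/p)^0 = 1`. [folklore] -/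
theorem singularSeriesFactor_empty (p : ℕ) : singularSeriesFactor ∅ p = 1 := by
  simp [singularSeriesFactor, tupleResidueCount_empty]

/-- The Euler factor of a singleton at a prime `p` is `(1 - 1/p) · (1 - 1/p)⁻¹ = 1`
(Hardy–Littlewood 1923, (5·664) with `m = 1`, `ν = 1`). [cite: HardyLittlewood1923, Theorem X 1, eq. (5.664), p. 61] -/
theorem singularSeriesFactor_singleton (h : ℤ) {p : ℕ} (hp : p.Prime) :
    singularSeriesFactor {h} p = 1 := by
  have hp1 : (1 : ℝ) < p := by exact_mod_cast hp.one_lt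
  have hp0 : (1 : ℝ) - 1 / p ≠ 0 := by
    have : (1 : ℝ) / p < 1 := (div_lt_one (by linarith)).2 hp1
    exact (sub_pos.2 this).ne'
  rw [singularSeriesFactor, tupleResidueCount_singleton, card_singleton, pow_one, Nat.cast_one,
    mul_inv_cancel₀ hp0]

/-- All ordered partial products of `𝔖(∅)` equal `1`. [folklore] -/
theorem singularSeriesPartial_empty (x : ℕ) : singularSeriesPartial ∅ x = 1 := by
  simp [singularSeriesPartial, singularSeriesFactor_empty]

/-- All ordered partial products of `𝔖({h})` equal `1`. [folklore] -/
theorem singularSeriesPartial_singleton (h : ℤ) (x : ℕ) : singularSeriesPartial {h} x = 1 := by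
  unfold singularSeriesPartial
  exact prod_eq_one fun p hp ↦ singularSeriesFactor_singleton h (Nat.prime_of_mem_primesLE hp)

/-- `𝔖(∅) = 1` (the empty Euler product, as the ordered limit of the constant partial products
`1`). [folklore] -/
theorem singularSeries_empty : singularSeries ∅ = 1 := by
  unfold singularSeries
  exact (Tendsto.congr (fun x ↦ (singularSeriesPartial_empty x).symm) tendsto_const_nhds).limUnder_eq

/-- `𝔖({h}) = 1` for every `h : ℤ`: in rank `m = 1` the singular series `G(b)` of
Hardy–Littlewood's Theorem X 1 is the empty-looking product `∏_ϖ (ϖ - 1)/(ϖ - 1) = 1`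
((5·664) with `ν = 1`). [cite: HardyLittlewood1923, Theorem X 1, eq. (5.664), p. 61] -/
theorem singularSeries_singleton (h : ℤ) : singularSeries {h} = 1 := by
  unfold singularSeries
  exact (Tendsto.congr (fun x ↦ (singularSeriesPartial_singleton h x).symm)
    tendsto_const_nhds).limUnder_eq

/-! ### The counting functions in rank `≤ 1` -/

/-- `π_∅(x) = #{1 ≤ n ≤ x} = x`. [folklore] -/
theorem primeTupleCount_empty (x : ℕ) : primeTupleCount ∅ x = x := by
  simp [primeTupleCount]

/-- `π(a) + #{p prime : a < p ≤ a + m} = π(a + m)`. [folklore] -/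
theorem primeCounting_add_card_filter_Ioc (a m : ℕ) :
    Nat.primeCounting a + #((Ioc a (a + m)).filter Nat.Prime) = Nat.primeCounting (a + m) := by
  rw [← Nat.primesLE_card_eq_primeCounting, ← Nat.primesLE_card_eq_primeCounting,
    Nat.primesLE_eq_filter_Ioc_zero, Nat.primesLE_eq_filter_Ioc_zero, ← card_union_of_disjoint,
    ← filter_union, Ioc_union_Ioc_eq_Ioc (Nat.zero_le a) (Nat.le_add_right a m)]
  exact disjoint_filter_filter (disjoint_left.2 fun b hb hb' ↦ by
    simp only [mem_Ioc] at hb hb'; omega)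

/-- `π(a + m) ≤ π(a) + m`: an interval of length `m` contains at most `m` primes. [folklore] -/
theorem primeCounting_add_le_add (a m : ℕ) :
    Nat.primeCounting (a + m) ≤ Nat.primeCounting a + m := by
  calc Nat.primeCounting (a + m)
      = Nat.primeCounting a + #((Ioc a (a + m)).filter Nat.Prime) :=
        (primeCounting_add_card_filter_Ioc a m).symm
    _ ≤ Nat.primeCounting a + #(Ioc a (a + m)) :=
        Nat.add_le_add_left (card_le_card (filter_subset _ _)) _
    _ = Nat.primeCounting a + m := by simp

/-- The rank-one counting function is a shifted prime count: for `h : ℤ`,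
`π_{h}(x) + π(h⁺) = π((x + h)⁺)` with `t⁺ = max(t, 0)` (`Int.toNat`), because `n ↦ n + h` maps
`{1 ≤ n ≤ x : n + h is a positive prime}` bijectively onto the primes in `(h⁺, (x + h)⁺]`.
[folklore] -/
theorem primeTupleCount_singleton_add_primeCounting (h : ℤ) (x : ℕ) :
    primeTupleCount {h} x + Nat.primeCounting h.toNat = Nat.primeCounting ((x : ℤ) + h).toNat := by
  obtain ⟨m, hm⟩ := Nat.exists_eq_add_of_le (show h.toNat ≤ ((x : ℤ) + h).toNat by omega)
  rw [hm, ← primeCounting_add_card_filter_Ioc, add_comm (Nat.primeCounting h.toNat), ← hm,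
    Nat.add_right_cancel_iff]
  unfold primeTupleCount
  refine card_nbij' (fun n : ℕ ↦ ((n : ℤ) + h).toNat) (fun p : ℕ ↦ ((p : ℤ) - h).toNat)
    (fun n hn ↦ ?_) (fun p hp ↦ ?_) (fun n hn ↦ ?_) (fun p hp ↦ ?_)
  · simp only [mem_coe, mem_filter, mem_Icc, mem_singleton, forall_eq] at hn
    simp only [mem_coe, mem_filter, mem_Ioc]
    exact ⟨⟨by omega, by omega⟩, hn.2.2⟩
  · simp only [mem_coe, mem_filter, mem_Ioc] at hp
    simp only [mem_coe, mem_filter, mem_Icc, mem_singleton, forall_eq]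
    have hp1 := hp.2.one_lt
    have e : ((((p : ℤ) - h).toNat : ℕ) + h : ℤ).toNat = p := by omega
    refine ⟨⟨by omega, by omega⟩, by omega, ?_⟩
    rw [e]
    exact hp.2
  · simp only [mem_coe, mem_filter, mem_Icc, mem_singleton, forall_eq] at hn
    dsimp only
    omega
  · simp only [mem_coe, mem_filter, mem_Ioc] at hp
    dsimp only
    omega

/-- `π_{0}(x) = π(x)`. [folklore] -/
theorem primeTupleCount_zero_singleton (x : ℕ) :
    primeTupleCount {0} x = Nat.primeCounting x := by
  simpa [Nat.primeCounting_zero] using primeTupleCount_singleton_add_primeCounting 0 x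

/-- Shifting by `h` changes the prime count by a bounded amount:
`|π_{h}(x) - π(x)| ≤ h⁺ + (−h)⁺ + π(h⁺)` for all `x`. [folklore] -/
theorem abs_primeTupleCount_singleton_sub_primeCounting_le (h : ℤ) (x : ℕ) :
    |(primeTupleCount {h} x : ℝ) - Nat.primeCounting x|
      ≤ h.toNat + (-h).toNat + Nat.primeCounting h.toNat := by
  have e := primeTupleCount_singleton_add_primeCounting h x
  set t : ℕ := ((x : ℤ) + h).toNat with ht
  have h1 : Nat.primeCounting t ≤ Nat.primeCounting x + h.toNat :=
    (Nat.monotone_primeCounting (show t ≤ x + h.toNat by omega)).trans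
      (primeCounting_add_le_add _ _)
  have h2 : Nat.primeCounting x ≤ Nat.primeCounting t + (-h).toNat :=
    (Nat.monotone_primeCounting (show x ≤ t + (-h).toNat by omega)).trans
      (primeCounting_add_le_add _ _)
  have e' : (primeTupleCount {h} x : ℝ) + Nat.primeCounting h.toNat = Nat.primeCounting t := by
    exact_mod_cast e
  have h1' : (Nat.primeCounting t : ℝ) ≤ Nat.primeCounting x + h.toNat := by exact_mod_cast h1
  have h2' : (Nat.primeCounting x : ℝ) ≤ Nat.primeCounting t + (-h).toNat := by exact_mod_cast h2
  have h3 : (0 : ℝ) ≤ Nat.primeCounting h.toNat := Nat.cast_nonneg _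
  have h4 : (0 : ℝ) ≤ (-h).toNat := Nat.cast_nonneg _
  have h5 : (0 : ℝ) ≤ h.toNat := Nat.cast_nonneg _
  rw [abs_sub_le_iff]
  constructor <;> linarith

/-! ### The prime number theorem along `ℕ` and along `ℝ` -/

/-- The prime number theorem along the natural numbers, `π(n) ∼ n / log n`, from the
real-variable named fact `Literature.NumberTheory.LFunctions.primeCounting_isEquivalent`
(`π(⌊x⌋₊) ∼ x / log x`) by restriction to `x = n`. [folklore] -/
theorem isEquivalent_primeCounting_natCast (hPNT : LFunctions.primeCounting_isEquivalent) :
    (fun x : ℕ ↦ (Nat.primeCounting x : ℝ)) ~[atTop] fun x : ℕ ↦ (x : ℝ) / Real.log x := by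
  have := hPNT.comp_tendsto tendsto_natCast_atTop_atTop
  simpa [Function.comp_def] using this

/-- `⌊x⌋₊ / log ⌊x⌋₊ ∼ x / log x` as `x → ∞` in `ℝ` (from `⌊x⌋₊ / x → 1`). [folklore] -/
theorem isEquivalent_natFloor_div_log :
    (fun x : ℝ ↦ (⌊x⌋₊ : ℝ) / Real.log ⌊x⌋₊) ~[atTop] fun x ↦ x / Real.log x := by
  have hfl : (fun x : ℝ ↦ (⌊x⌋₊ : ℝ)) ~[atTop] fun x ↦ x :=
    isEquivalent_of_tendsto_one (by
      simpa only [Pi.div_def] using tendsto_nat_floor_div_atTop (R := ℝ))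
  have h0 : Tendsto (fun x : ℝ ↦ Real.log ⌊x⌋₊ - Real.log x) atTop (𝓝 0) := by
    have := ((Real.continuousAt_log one_ne_zero).tendsto.comp
      (tendsto_nat_floor_div_atTop (R := ℝ)))
    rw [Real.log_one] at this
    refine this.congr' ?_
    filter_upwards [eventually_ge_atTop 1] with x hx
    have hx0 : (0 : ℝ) < x := by linarith
    have hfl0 : (0 : ℝ) < ⌊x⌋₊ := by exact_mod_cast Nat.floor_pos.2 hx
    simp only [Function.comp_apply, Real.log_div hfl0.ne' hx0.ne']
  have hlog : (fun x : ℝ ↦ Real.log ⌊x⌋₊) ~[atTop] fun x ↦ Real.log x :=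
    ((isLittleO_one_iff ℝ).2 h0).trans_isBigO
      ((isLittleO_one_left_iff ℝ).2 (tendsto_norm_atTop_atTop.comp Real.tendsto_log_atTop)).isBigO
  simpa only [Pi.div_def] using hfl.div hlog

/-- The real-variable prime number theorem `π(⌊x⌋₊) ∼ x / log x` from its form along `ℕ`
(compose with `⌊·⌋₊` and use `⌊x⌋₊ / log ⌊x⌋₊ ∼ x / log x`). [folklore] -/
theorem primeCounting_isEquivalent_of_natCast
    (hπ : (fun x : ℕ ↦ (Nat.primeCounting x : ℝ)) ~[atTop] fun x : ℕ ↦ (x : ℝ) / Real.log x) :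
    LFunctions.primeCounting_isEquivalent :=
  (hπ.comp_tendsto tendsto_nat_floor_atTop).trans isEquivalent_natFloor_div_log

/-! ### Rank `≤ 1` of the prime `k`-tuples conjecture -/

/-- **Rank one.** Under the prime number theorem, `π_{h}(x) ∼ x / log x` for every shift
`h : ℤ`: `π_{h} - π = O(1) = o(x / log x)`. [cite: HardyLittlewood1923, Theorem X 1 (p. 61), case m = 1] -/
theorem isEquivalent_primeTupleCount_singleton (hPNT : LFunctions.primeCounting_isEquivalent)
    (h : ℤ) :
    (fun x : ℕ ↦ (primeTupleCount {h} x : ℝ)) ~[atTop] fun x : ℕ ↦ (x : ℝ) / Real.log x := by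
  have hπ := (isEquivalent_primeCounting_natCast hPNT).isLittleO
  have hB : (fun x : ℕ ↦ (primeTupleCount {h} x : ℝ) - Nat.primeCounting x) =O[atTop]
      fun _ : ℕ ↦ (1 : ℝ) := by
    refine IsBigO.of_bound (h.toNat + (-h).toNat + Nat.primeCounting h.toNat : ℝ)
      (Eventually.of_forall fun x ↦ ?_)
    simpa only [Real.norm_eq_abs, norm_one, mul_one] using
      abs_primeTupleCount_singleton_sub_primeCounting_le h x
  have h1 : (fun _ : ℕ ↦ (1 : ℝ)) =o[atTop] fun x : ℕ ↦ (x : ℝ) / Real.log x := by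
    refine (isLittleO_one_left_iff ℝ).2 ?_
    simpa only [Function.comp_def, Real.norm_eq_abs, pow_one] using
      tendsto_abs_atTop_atTop.comp (tendsto_natCast_div_log_pow_atTop 1)
  refine (((hB.trans_isLittleO h1).add hπ).congr_left fun x ↦ ?_)
  simp only [Pi.sub_apply]
  ring

/-- **Rank zero, unconditionally.** For `H = ∅` the Hardy–Littlewood asymptotic reads `x ∼ x`:
`π_∅(x) = x`, `𝔖(∅) = 1`, `(log x)^0 = 1`. [folklore] -/
theorem hardyLittlewoodTuples_empty :
    (fun x : ℕ ↦ (primeTupleCount ∅ x : ℝ)) ~[atTop]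
      fun x : ℕ ↦ singularSeries ∅ * x / Real.log x ^ (∅ : Finset ℤ).card := by
  simp only [primeTupleCount_empty, singularSeries_empty, card_empty, pow_zero, div_one, one_mul]
  exact IsEquivalent.refl

/-- **Rank one, from the prime number theorem.** For `H = {h}` the Hardy–Littlewood asymptotic
`π_{h}(x) ∼ 𝔖({h}) x / log x = x / log x` holds, given `π(x) ∼ x / log x`.
[cite: HardyLittlewood1923, Theorem X 1 (p. 61), case m = 1] -/
theorem hardyLittlewoodTuples_singleton (hPNT : LFunctions.primeCounting_isEquivalent) (h : ℤ) :
    (fun x : ℕ ↦ (primeTupleCount {h} x : ℝ)) ~[atTop]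
      fun x : ℕ ↦ singularSeries {h} * x / Real.log x ^ ({h} : Finset ℤ).card := by
  simp only [singularSeries_singleton, card_singleton, pow_one, one_mul]
  exact isEquivalent_primeTupleCount_singleton hPNT h

/-- **The prime `k`-tuples conjecture holds in rank `k ≤ 1`, given the prime number theorem**
(no admissibility hypothesis is needed: `∅` and singletons are admissible). This is all of
`Literature.NumberTheory.Sieve.HardyLittlewoodTuples` that is known; rank `2` contains the twin prime conjecture.
[cite: HardyLittlewood1923, Theorem X 1 (p. 61), cases m = 0, 1] -/
theorem hardyLittlewoodTuples_of_card_le_one (hPNT : LFunctions.primeCounting_isEquivalent)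
    {H : Finset ℤ} (hH : H.card ≤ 1) :
    (fun x : ℕ ↦ (primeTupleCount H x : ℝ)) ~[atTop]
      fun x : ℕ ↦ singularSeries H * x / Real.log x ^ H.card := by
  rcases Nat.le_one_iff_eq_zero_or_eq_one.1 hH with h0 | h1
  · obtain rfl := Finset.card_eq_zero.1 h0
    exact hardyLittlewoodTuples_empty
  · obtain ⟨h, rfl⟩ := Finset.card_eq_one.1 h1
    exact hardyLittlewoodTuples_singleton hPNT h

/-- **The prime `k`-tuples conjecture implies the prime number theorem**: its instance `H = {0}`
is `π(x) ∼ x / log x` along `ℕ`, which transfers to the real-variable form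
`Literature.NumberTheory.LFunctions.primeCounting_isEquivalent`. [cite: HardyLittlewood1923, Theorem X 1 (p. 61), case m = 1] -/
theorem HardyLittlewoodTuples.primeCounting_isEquivalent (hHL : HardyLittlewoodTuples) :
    LFunctions.primeCounting_isEquivalent := by
  refine primeCounting_isEquivalent_of_natCast ?_
  have h := hHL {0} (isAdmissibleTuple_singleton 0)
  simp only [singularSeries_singleton, card_singleton, pow_one, one_mul,
    primeTupleCount_zero_singleton] at h
  exact h

/-- **Rank `≤ 1` of the prime `k`-tuples conjecture is equivalent to the prime number theorem.**
The left side is `Literature.NumberTheory.Sieve.HardyLittlewoodTuples` with the extra hypothesis `#H ≤ 1`.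
[cite: HardyLittlewood1923, Theorem X 1 (p. 61), cases m = 0, 1] -/
theorem hardyLittlewoodTuples_card_le_one_iff :
    (∀ H : Finset ℤ, H.card ≤ 1 → IsAdmissibleTuple H →
      (fun x : ℕ ↦ (primeTupleCount H x : ℝ)) ~[atTop]
        fun x : ℕ ↦ singularSeries H * x / Real.log x ^ H.card) ↔
    LFunctions.primeCounting_isEquivalent := by
  refine ⟨fun hHL ↦ primeCounting_isEquivalent_of_natCast ?_,
    fun hPNT H hH _ ↦ hardyLittlewoodTuples_of_card_le_one hPNT hH⟩
  have h := hHL {0} (by simp) (isAdmissibleTuple_singleton 0)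
  simp only [singularSeries_singleton, card_singleton, pow_one, one_mul,
    primeTupleCount_zero_singleton] at h
  exact h

end Literature.NumberTheory.Sieve
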